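/-
COR-CM (cell pub-hodgecm2, stage 2 of the Hodge ladder) — count-neutral KERNEL CENSUS TRANSPORT «the Markman column of the cyclic
decic type, CLOSED» (seat prover-pub-hodgecm2-b09-g21-0, binder prover b09, gen 21; own lane DECIC-MARKMAN-TRANSPORT, HOME/INBOX.md
l.4703/l.4704/l.5150; last file of the lane: composition BY NAME of `Census/DecicFaceTransportOfMarkman.lean` (two face periods + one
known product) with `CorCM/DecicInducedTimesHalfCircleHodgeOfMarkman.lean` (that product, modulo Markman)).  Theorems only; no definition,
no named fact, nothing asserted; `Interfaces.lean` (C1), every E term, `B01/*`, `Transposition/*` untouched.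
HONEST FRAMING (COORDINATOR RULING — HODGE FRAMING CORRECTION, 2026-08-21T11:55:35Z): `HC_CM` is NOT proved, here or anywhere in the
tree.  The closing theorem is CONDITIONAL on TWO face periods of ONE field (instances of the crux) and on the displayed named fact
`HodgeTheory.Markman2025_weilClasses_algebraic_hyperbolicSixfold` (E. Markman, arXiv:2502.03415 Thm 1.5.1, UNREFEREED).
T5 (coordinator ruling 15:33:56Z (3)): binder set = seat b23's landed `…_decicCyclic_aut` set {dictionary (ε, hε, c, hc, hεc), face
readings, face periods} MINUS the third face period PLUS {Markman's named fact, the imaginary quadratic subfield data (k, h2, i) —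
inhabited for every cyclic decic CM field}; no `¬` theorem in the tree against any of them; no contradiction derivable; checker: self
(prover-pub-hodgecm2-b09-g21-0), 2026-08-21.
-/
import Summits.HodgeConjecture.CorCM.Census.DecicFaceTransportOfMarkman
import Summits.HodgeConjecture.CorCM.DecicInducedTimesHalfCircleHodgeOfMarkman
import Summits.HodgeConjecture.CorCM.QuarticCMConjugationSquare
import HarnessLib

/-!
# Degree 10, cyclic type: TWO face periods + Markman's sixfold theorem close the slice (automorphism form, CLOSED)

The dictionary a field-specific seat has (seat b23's `…_decicCyclic_aut` form): a base embedding `σ₀`, a bijection `ε : Aut(K) ≃ Fin 10`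
multiplicative for seat b30's table (addition mod `10`), the automorphism `c` inducing complex conjugation at `σ₀` with `ε c = 5`, faces
`R₁`, `R₂` described through `ε` as `(31;33,66)`, `(31;33,132)`, and an imaginary quadratic field `k` with `i : k → K` (the fixed field
of `⟨g₁²⟩`).  From these: `g₁ := ε⁻¹ 1` generates `Gal(K/ℚ)` (`orderOf_gen`), `R₁.Φ` is the half-circle type `{σ₀ ∘ g₁ⁿ : n < 5}`
(`halfCircle_of_reads`), the type `Ψ = {\\overline{σ₀ ∘ i}}` of `k` (`singletonType`) induces the type `Ψ^K` of `K`, which READS AS the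
odd residues `682` by the parity law of b09 gen 18's cyclic frame (`DecicCurveFivefold.exists_cyclicFrame`; `induced_reads_odd`); so
`CorCM/DecicInducedTimesHalfCircleHodgeOfMarkman.lean` supplies `HodgeConjectureFor (A_{(K,Ψ^K)} × A_{(K,R₁.Φ)})` modulo Markman, and
`DecicFaceTransport.CyclicMarkman.hodgeConjectureFor_of_avDominatedBy_isProductOf_of_two_facePeriods_of_hodgeConjectureFor_decicCyclic`
closes:

  period witnesses on the TWO faces `R₁`, `R₂` ∧ Markman's hyperbolic-sixfold theorem
    ⟹ the Hodge conjecture, in every codimension, for every complex abelian variety dominated by a finite product of abelian varieties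
      realising CM types of CM fields embeddable in `K`

(`hodgeConjectureFor_of_avDominatedBy_isProductOf_of_two_facePeriods_decicCyclic_of_markman_aut`).  Seat b23's theorem needs THREE
face periods; the lattice census (`work/decic_lattice.py` of the seat folder, exact) shows two is optimal modulo both Markman columns.
`HC_CM` is NOT proved; no period is produced here.

References: [cite: Markman2025SecantWeil, Thm 1.5.1]; [cite: Pohlmann1968, Thm. 1]; [cite: Milne1999LefschetzClasses, Thm. 3.2 and Cor.
4.5]; [cite: Shimura1998, §6.2 Theorem 3, §6.1 Corollary of Theorem 2 (pp. 41–43), §8.4]; [cite: MumfordAV1970, §19 Thm. 1 and p. 169].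
-/

noncomputable section

open CategoryTheory NumberField NumberField.ComplexEmbedding
open Literature.AlgebraicGeometry Literature.AlgebraicGeometry.Motives Literature.AlgebraicGeometry.HodgeTheory
open Literature.AlgebraicGeometry.ComplexMultiplication Literature.AlgebraicGeometry.Milne1999
open Literature.NumberTheory.Automorphic Literature.NumberTheory.Automorphic.PicardCM
open Literature.NumberTheory.ComplexMultiplication (inducedCMType mem_inducedCMType_iff)
open Literature.NumberTheory.ComplexMultiplication.CMTypeOps
open Summit.HodgeConjecture.CorCM.Census.FaceSquaresModel
open Summit.HodgeConjecture.CorCM.Census.DecicFaceSquaresCyclic (Γ)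
open Summit.HodgeConjecture.CorCM.FaceCensus
open Summit.HodgeConjecture.CorCM.Domination
open Summit.HodgeConjecture.CorCM.CyclicSextic (emb emb_apply)

namespace Summit.HodgeConjecture.CorCM.DecicFaceTransport.CyclicMarkman

/-! ## §1 The generator `ε⁻¹ 1`, the half-circle type, the singleton type of `k`, the parity reading -/

section Aut

variable {K : Type} [Field K] [NumberField K] (ε : (K ≃ₐ[ℚ] K) ≃ Fin 10)

/-- Seat b30's table is addition on `Fin 10`; masks `31` and `682` are `{i < 5}` and the odd residues. [folklore] -/
theorem table_facts : (∀ i j : Fin 10, Γ.mul i j = i + j) ∧ (∀ i : Fin 10, mem i 31 = true ↔ i.val < 5) ∧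
    (∀ i : Fin 10, mem i 682 = true ↔ i.val % 2 = 1) := by
  refine ⟨?_, ?_, ?_⟩ <;> decide

/-- **`ε` reads powers of `g₁ = ε⁻¹ 1` as residues**: `ε (g₁ⁿ) = n (mod 10)`. [folklore] -/
theorem enum_pow_gen (hε : ∀ g h : K ≃ₐ[ℚ] K, ε (g * h) = Γ.mul (ε g) (ε h)) (n : ℕ) : (ε (ε.symm 1 ^ n)).val = n % 10 := by
  have h1 : ε 1 = 0 := by
    have h := hε 1 1
    rw [mul_one, table_facts.1] at h
    exact (left_eq_add.mp h)
  induction n with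
  | zero => rw [pow_zero, h1]; rfl
  | succ n ih => rw [pow_succ, hε, table_facts.1, Fin.val_add, ih, ε.apply_symm_apply]; simp [Nat.add_mod]

/-- Every automorphism is the power `g₁^{ε g}` of `g₁ = ε⁻¹ 1`. [folklore] -/
theorem eq_gen_pow (hε : ∀ g h : K ≃ₐ[ℚ] K, ε (g * h) = Γ.mul (ε g) (ε h)) (g : K ≃ₐ[ℚ] K) : g = ε.symm 1 ^ (ε g).val :=
  ε.injective (Fin.ext (by rw [enum_pow_gen ε hε, Nat.mod_eq_of_lt (ε g).isLt]))

/-- **`g₁ = ε⁻¹ 1` has order `10`** (so it generates the cyclic group `Gal(K/ℚ)`). [folklore] -/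
theorem orderOf_gen (hε : ∀ g h : K ≃ₐ[ℚ] K, ε (g * h) = Γ.mul (ε g) (ε h)) : orderOf (ε.symm 1) = 10 := by
  have h1 : (ε 1).val = 0 := by
    have h := hε 1 1
    rw [mul_one, table_facts.1] at h
    rw [left_eq_add.mp h]; rfl
  rw [orderOf_eq_iff (by norm_num)]
  refine ⟨ε.injective (Fin.ext ?_), fun m hm hm0 h => ?_⟩
  · rw [enum_pow_gen ε hε, h1]
  · have h' := congrArg (fun x => (ε x).val) h
    simp only [enum_pow_gen ε hε, h1, Nat.mod_eq_of_lt hm] at h'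
    omega

/-- `σ₀ ∘ g₁ⁿ` is the frame embedding `emb g₁ σ₀ n`. [folklore] -/
theorem comp_gen_pow (σ₀ : K →+* ℂ) (n : ℕ) : σ₀.comp ((ε.symm 1 ^ n : K ≃ₐ[ℚ] K) : K →+* K) = emb (ε.symm 1) σ₀ n :=
  RingHom.ext fun _ => rfl

variable [IsGalois ℚ K]

/-- **A type reading as `31` through `ε` at `σ₀` is the half-circle type** `{σ₀ ∘ g₁ⁿ : n < 5}` of `g₁ = ε⁻¹ 1`. [folklore] -/
theorem halfCircle_of_reads (hε : ∀ g h : K ≃ₐ[ℚ] K, ε (g * h) = Γ.mul (ε g) (ε h)) (σ₀ : K →+* ℂ) (Φ : CMType K)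
    (hΦ : ∀ g : K ≃ₐ[ℚ] K, σ₀.comp (g : K →+* K) ∈ Φ.1 ↔ mem (ε g) 31 = true) (s : K →+* ℂ) :
    s ∈ Φ.1 ↔ ∃ n : ℕ, n < 5 ∧ s = emb (ε.symm 1) σ₀ n := by
  obtain ⟨g, rfl⟩ := exists_aut_eq σ₀ s
  rw [hΦ, table_facts.2.1]
  constructor
  · intro hg
    refine ⟨(ε g).val, hg, ?_⟩
    rw [← comp_gen_pow ε σ₀, ← eq_gen_pow ε hε g]
  · rintro ⟨n, hn, h⟩
    rw [← comp_gen_pow ε σ₀] at h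
    rw [comp_aut_injective σ₀ h, enum_pow_gen ε hε]
    omega

end Aut

/-- **The CM type `{τ}` of an imaginary quadratic field** (`[k:ℚ] = 2`, `k` CM): for every `τ : k → ℂ` there is a CM type `Ψ` of `k`
with `t ∈ Ψ ↔ t = τ`. [folklore] -/
theorem singletonType {k : Type} [Field k] [NumberField k] [IsCMField k] (h2 : Module.finrank ℚ k = 2) (τ : k →+* ℂ) :
    ∃ Ψ : CMType k, ∀ t : k →+* ℂ, t ∈ Ψ.1 ↔ t = τ := by
  have hτ : conjugate τ ≠ τ := fun h =>
    IsTotallyComplex.complexEmbedding_not_isReal τ (ComplexEmbedding.isReal_iff.mpr h)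
  refine ⟨⟨{t | t = τ}, fun φ => ?_⟩, fun t => Iff.rfl⟩
  change φ = τ ↔ ¬ conjugate φ = τ
  constructor
  · rintro rfl
    exact hτ
  · intro h
    rcases QuarticCM.eq_or_eq_conjugate_of_finrank_eq_two h2 τ φ with h' | h'
    · exact h'
    · exact absurd (by rw [h']; exact star_star τ) h

/-- **The induced type reads as the odd residues.**  For a cyclic decic Galois CM field `K` with the dictionary `(σ₀, ε)`, an imaginary
quadratic `k` with `i : k → K` and the type `Ψ = {\\overline{σ₀ ∘ i}}` of `k`: `σ₀ ∘ g ∈ Ψ^K ↔ ε g` is ODD — the parity law of b09 gen 18's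
cyclic frame (`DecicCurveFivefold.exists_cyclicFrame`: `s|_k = τ ↔ e s` odd, `e (σ₀ ∘ g₁ⁿ) = n`). [cite: Shimura1998, §8.4] -/
theorem induced_reads_odd {K : Type} [Field K] [NumberField K] [IsCMField K] [IsGalois ℚ K] (ε : (K ≃ₐ[ℚ] K) ≃ Fin 10)
    (hε : ∀ g h : K ≃ₐ[ℚ] K, ε (g * h) = Γ.mul (ε g) (ε h)) (h10 : Module.finrank ℚ K = 10) (σ₀ : K →+* ℂ)
    {k : Type} [Field k] [NumberField k] [IsCMField k] (h2 : Module.finrank ℚ k = 2) (i : k →+* K)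
    {Ψ : CMType k} (hΨ : ∀ t : k →+* ℂ, t ∈ Ψ.1 ↔ t = conjugate (σ₀.comp i)) (g : K ≃ₐ[ℚ] K) :
    σ₀.comp (g : K →+* K) ∈ (inducedCMType i Ψ).1 ↔ mem (ε g) 682 = true := by
  obtain ⟨δ, d, hd, -, hτ⟩ := DecicInducedTimesHalfCircle.exists_sqrt_neg_nat k h2 (conjugate (σ₀.comp i))
  have hp : σ₀.comp i = conjugate (conjugate (σ₀.comp i)) := (star_star _).symm
  obtain ⟨e, he, he_sign, -, -⟩ := DecicCurveFivefold.exists_cyclicFrame h10 h2 (orderOf_gen ε hε) σ₀ i hd hτ hp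
  rw [mem_inducedCMType_iff, hΨ, he_sign, table_facts.2.2]
  have hs : σ₀.comp (g : K →+* K) = emb (ε.symm 1) σ₀ (ε g).val := by
    conv_lhs => rw [eq_gen_pow ε hε g]
    exact comp_gen_pow ε σ₀ _
  rw [hs, he, ZMod.val_natCast, Nat.mod_eq_of_lt (ε g).isLt]

/-! ## §2 FIELD CLOSURE from TWO face periods and Markman's theorem (automorphism form) -/

/-- **FIELD CLOSURE, type `ℤ/10` (cyclic decic) — TWO face periods + Markman, from AUTOMORPHISM data (CLOSED).**  `K` a Galois CM field, `σ₀`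
a base embedding, `ε : Aut(K) ≃ Fin 10` multiplicative for b30's table, `c` the automorphism inducing complex conjugation at `σ₀` with
`ε c = 5`; faces `R₁`, `R₂` of `K` described through `ε` as `(31;33,66)`, `(31;33,132)` (`σ₀ ∘ g ∈ Rᵢ.Φ ↔ ε g ∈ {0,…,4}`, place
representatives `σ₀ ∘ g_p`, `σ₀ ∘ g_q`); an imaginary quadratic field `k` with `i : k → K`.  ONE period witness for each of `R₁`, `R₂` on
the universe of record together with Markman's hyperbolic-sixfold theorem implies the Hodge conjecture, in every codimension, for every
complex abelian variety dominated by a finite product of abelian varieties realising CM types of CM fields embeddable in `K`.  NO other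
hypothesis.  (FRAMING: conditional on these 2 face periods — instances of the crux — and on Markman's UNREFEREED theorem; seat b23's
`…_decicCyclic_aut` needs 3 periods; `HC_CM` is not proved.) [cite: Markman2025SecantWeil, Thm 1.5.1] [cite: Shimura1998, §6.2 Theorem 3
and §6.1 Corollary of Theorem 2 (pp. 41–43)] [cite: Pohlmann1968, Thm. 1] [cite: Milne1999LefschetzClasses, Thm. 3.2 and Cor. 4.5]
[cite: MumfordAV1970, §19 Thm. 1 and p. 169] -/
theorem hodgeConjectureFor_of_avDominatedBy_isProductOf_of_two_facePeriods_decicCyclic_of_markman_aut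
    (hM : Markman2025_weilClasses_algebraic_hyperbolicSixfold) (K : CMField) [IsGalois ℚ K]
    (σ₀ : (K : Type) →+* ℂ) (ε : ((K : Type) ≃ₐ[ℚ] (K : Type)) ≃ Fin 10)
    (hε : ∀ g h : ((K : Type) ≃ₐ[ℚ] (K : Type)), ε (g * h) = Γ.mul (ε g) (ε h))
    (c : ((K : Type) ≃ₐ[ℚ] (K : Type))) (hc : σ₀.comp (c : (K : Type) →+* (K : Type)) = conjugate σ₀) (hεc : ε c = Γ.conj)
    (R₁ R₂ : Face K) (g₁ g₁' g₂ g₂' : ((K : Type) ≃ₐ[ℚ] (K : Type)))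
    (hΦ₁ : ∀ g : ((K : Type) ≃ₐ[ℚ] (K : Type)), σ₀.comp (g : (K : Type) →+* (K : Type)) ∈ R₁.Φ.1 ↔ mem (ε g) 31 = true)
    (hp₁ : R₁.p = σ₀.comp (g₁ : (K : Type) →+* (K : Type))) (hp₁' : Γ.placeMask (ε g₁) = 33)
    (hq₁ : R₁.p' = σ₀.comp (g₁' : (K : Type) →+* (K : Type))) (hq₁' : Γ.placeMask (ε g₁') = 66)
    (hΦ₂ : ∀ g : ((K : Type) ≃ₐ[ℚ] (K : Type)), σ₀.comp (g : (K : Type) →+* (K : Type)) ∈ R₂.Φ.1 ↔ mem (ε g) 31 = true)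
    (hp₂ : R₂.p = σ₀.comp (g₂ : (K : Type) →+* (K : Type))) (hp₂' : Γ.placeMask (ε g₂) = 33)
    (hq₂ : R₂.p' = σ₀.comp (g₂' : (K : Type) →+* (K : Type))) (hq₂' : Γ.placeMask (ε g₂') = 132)
    {k : Type} [Field k] [NumberField k] [IsCMField k] (h2 : Module.finrank ℚ k = 2) (i : k →+* (K : Type))
    (h₁ : ∃ ι₁ : K →+* ℂ, R₁.Admissible ι₁ ∧ ∃ (V : HermSpace3 K ι₁) (σ : K →+* ℂ),
      (Model.picardCMUniverse exists_isReal_hodgeModel_holds hodgePQ_independent_of_hodgeModel_holds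
        BallQuotient.ballQuotientUniformised_holds cmAbelianVarietyRealised_holds).PeriodNV ι₁ V K R₁.psi σ)
    (h₂ : ∃ ι₁ : K →+* ℂ, R₂.Admissible ι₁ ∧ ∃ (V : HermSpace3 K ι₁) (σ : K →+* ℂ),
      (Model.picardCMUniverse exists_isReal_hodgeModel_holds hodgePQ_independent_of_hodgeModel_holds
        BallQuotient.ballQuotientUniformised_holds cmAbelianVarietyRealised_holds).PeriodNV ι₁ V K R₂.psi σ)
    {P A : AbelianVariety ℂ} (hP : AbelianVariety.IsProductOf (fun B : AbelianVariety ℂ =>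
      ∃ (E : Type) (_ : Field E) (_ : NumberField E) (_ : IsCMField E) (_ : E →+* (K : Type)) (Φ : CMType E)
        (ι : 𝓞 E →+* End B) (θ : E →+* Module.End ℂ (complexBetti B.X 1)),
        IsCMTypeRealisation Φ B ι θ) P)
    (hA : AVDominatedBy A P) : HodgeConjectureFor A.dim A.X := by
  -- the dictionary on `GalT K`
  obtain ⟨e, hmul, he⟩ := exists_enum_of_autEnum Γ σ₀ ε hε
  have hconj : e conjT = Γ.conj := by rw [conjT_eq_translate σ₀, ← hc, he, hεc]
  have h10 : Module.finrank ℚ K = 10 := (eq_finrank_of_enum e).symm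
  -- the type `{σ̄₀|_k}` of `k` and the induced type, reading as the odd residues
  obtain ⟨Ψ, hΨ⟩ := singletonType h2 (conjugate (σ₀.comp i))
  have hΘ : ∀ Q : GalT K, Q.1 σ₀ ∈ (inducedCMType i Ψ).1 ↔ mem (e Q) 682 = true := by
    intro Q
    obtain ⟨g, hg⟩ := exists_aut_eq σ₀ (Q.1 σ₀)
    have hQ : Q = translate σ₀ (σ₀.comp (g : (K : Type) →+* (K : Type))) := by rw [← hg, translate_apply_eq]
    rw [hg, induced_reads_odd ε hε h10 σ₀ h2 i hΨ, hQ, he]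
  -- the Markman column and the two-period transport
  exact hodgeConjectureFor_of_avDominatedBy_isProductOf_of_two_facePeriods_of_hodgeConjectureFor_decicCyclic K e hmul hconj σ₀ R₁ R₂
    (reads_of_autEnum Γ e σ₀ ε he R₁ hΦ₁ hp₁ hp₁' hq₁ hq₁') (reads_of_autEnum Γ e σ₀ ε he R₂ hΦ₂ hp₂ hp₂' hq₂ hq₂')
    (inducedCMType i Ψ) hΘ
    (DecicInducedTimesHalfCircle.hodgeConjectureFor_cmProdAV_induced_halfCircle_of_markmanSixfold hM h10 h2 i (orderOf_gen ε hε) σ₀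
      hΨ (halfCircle_of_reads ε hε σ₀ R₁.Φ hΦ₁))
    h₁ h₂ hP hA

end Summit.HodgeConjecture.CorCM.DecicFaceTransport.CyclicMarkman

end
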